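import Summits.ResolutionOfSingularities.ResolutionOfSingularities.Theorems.FrobeniusLadderFInjectiveMacaulayficationFCentreE1TierOneNormPow
import Summits.ResolutionOfSingularities.ResolutionOfSingularities.Theorems.FrobeniusLadderFInjectiveMacaulayficationLemmaNAssembly
import Summits.ResolutionOfSingularities.ResolutionOfSingularities.Theorems.FrobeniusLadderFInjectiveMacaulayficationMonomialPBasisBlockForm
import Mathlib.FieldTheory.Finite.Basic
import Mathlib.RingTheory.Localization.LocalizationLocalization
import HarnessLib

/-!
# ★★★ `¬ LFBAdm 2 1 4`, UNCONDITIONAL — the first NEGATIVE F-centre row in the kernel: at `d = 4`, `p = 2` the `e = 1` Frobenius-norm blow-up is NOT an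
# admissible FULL-ifying centre (crux `FInjectiveMacaulayfication` stmt-ResolutionOfSingularities-15315, chain w45a, F-centre census #360′; res-L1-w45a-plan-1 RULING
# R18.6 (E2); seat res-L1-w45a-stub-1 g10)

[OURS · L1 W4.5a] Support file (`--supports stmt-ResolutionOfSingularities-15315 --as helper`); a statement about the CANDIDATE census predicate
`FCentreCandidate.LFBAdm` (OURS); replaces the role of NO printed item; NOT a statement of the manuscript; def-free; AI-written (AI review is weaker than expert
review).

ASSEMBLY (all pieces by name): LEMMA N♭ `LemmaNAssembly.isFrobeniusNormIdeal_pow_eight` (res-L1-w45a-lead-1 g8: pieces (J) `JacobiMinor`, (Q) `NormBlockMatrix`,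
(C) `NormBlockCerts`, (D) `NormBlockDuality`, (S) `FrobeniusNormMinors`, (A) `UnitRowMinors`, (B′) `BlockDiagonalMinors`, (L) `FrobeniusNormExtendScale`) instantiated
at `A₀ = k[x,y,u,t,z]/(z² + x⁴z + y³ + u³ + t³)`, `k` perfect of characteristic 2, through the `K²`-basis bridge (B)/(E1) `MonomialPBasisBlockForm`
(`exists_blockBasis`, `exists_eq_sum_sq_blockGenerators`, scalar binders) ⇒ §2 `isFrobeniusNormIdeal_pow_eight_A₀ : IsFrobeniusNormIdeal K 2 1 (𝔮̄⁸)`,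
`𝔮̄ = (x̄², ȳ, ū, t̄, z̄)`, for EVERY fraction field `K` of `A₀`; §1 `isFractionRing_of_isLocalization_of_isFractionRing` (a fraction field of a localisation
of a domain is a fraction field of the domain) feeds it the fraction fields of the stalk `𝒪_v`; (L) `IsFrobeniusNormIdeal.map_of_isLocalization` moves `𝔮̄⁸`
to `𝒪_v` (the binder's `φ = germ ∘ ΓSpecIso⁻¹` IS Mathlib's `StructureSheaf.stalkAlgebra`, definitionally); and res-L1-w45a-stub-2's
`FCentreE1TierOneNormPow.not_lFBAdm_two_one_four_of_normPow` (Tier 1: the Frobenius-norm blow-up is the blow-up along `𝔮̄ⁿ`, whose chart origin is NOT FULL)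
closes at `k = ZMod 2`, `n = 8`, `c = 1`: §3 ★★★ `not_lFBAdm_two_one_four : ¬ FCentreCandidate.LFBAdm 2 1 4`.
[OURS · certificate; cite: Villamayoru2006, §2, Thm. 3.3 and 3.4; Yasuda2012, Def. 2.2 and Cor. 2.6]
-/

-- single-problem summit: the doubled namespace component is forced
set_option linter.dupNamespace false

noncomputable section

namespace Summit.ResolutionOfSingularities.ResolutionOfSingularities.Theorems.FInjectiveMacaulayfication.NotLFBAdmTwoOneFour

open AlgebraicGeometry MvPolynomial Literature.AlgebraicGeometry.Resolution
open Summit.ResolutionOfSingularities.ResolutionOfSingularities.Theorems.FInjectiveMacaulayfication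

/-! ## §1 A fraction field of a localisation of a domain is a fraction field of the domain -/

/-- If `S = M⁻¹R` for a domain `R` (`M ≤ R⁰`) and `T = Frac S`, then `T = Frac R` along the composite algebra. [folklore] -/
theorem isFractionRing_of_isLocalization_of_isFractionRing {R S T : Type*} [CommRing R] [IsDomain R] [CommRing S] [IsDomain S]
    [CommRing T] [Algebra R S] [Algebra R T] [Algebra S T] [IsScalarTower R S T] (M : Submonoid R) [IsLocalization M S]
    (hM : M ≤ nonZeroDivisors R) [IsFractionRing S T] : IsFractionRing R T := by
  have h := IsLocalization.localization_localization_isLocalization_of_has_all_units M (nonZeroDivisors S) T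
    (fun x hx => hx.mem_nonZeroDivisors)
  have hc : (nonZeroDivisors S).comap (algebraMap R S) = nonZeroDivisors R := by
    ext a
    simp only [Submonoid.mem_comap, mem_nonZeroDivisors_iff_ne_zero]
    exact map_ne_zero_iff _ (IsLocalization.injective S hM)
  rw [hc] at h
  exact h

/-! ## §2 LEMMA N♭ at the specimen ring `A₀` -/

universe u

/-- ★★ **LEMMA N♭**: for `k` PERFECT of characteristic 2, `f = X₄² + X₀⁴X₄ + X₁³ + X₂³ + X₃³`, `A₀ = k[X₀..X₄]/(f)` and ANY fraction field `K` of `A₀` (same universe),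
`𝔮̄⁸ = (x̄², ȳ, ū, t̄, z̄)⁸` is a first Frobenius norm ideal of `A₀` in `K`. [OURS · LEMMA N♭ = `LemmaNAssembly` ∘ `MonomialPBasisBlockForm`] -/
theorem isFrobeniusNormIdeal_pow_eight_A₀ (k : Type u) [Field k] [CharP k 2] [PerfectRing k 2] (f : MvPolynomial (Fin 5) k)
    (hf : f = X 4 ^ 2 + X 0 ^ 4 * X 4 + X 1 ^ 3 + X 2 ^ 3 + X 3 ^ 3)
    (K : Type u) [Field K] [Algebra (MvPolynomial (Fin 5) k ⧸ Ideal.span {f}) K] [IsFractionRing (MvPolynomial (Fin 5) k ⧸ Ideal.span {f}) K]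
    [ExpChar K 2] :
    IsFrobeniusNormIdeal K 2 1 ((Ideal.span {Ideal.Quotient.mk (Ideal.span {f}) (X 0) ^ 2, Ideal.Quotient.mk (Ideal.span {f}) (X 1),
      Ideal.Quotient.mk (Ideal.span {f}) (X 2), Ideal.Quotient.mk (Ideal.span {f}) (X 3), Ideal.Quotient.mk (Ideal.span {f}) (X 4)}) ^ 8) := by
  haveI : IsDomain (MvPolynomial (Fin 5) k ⧸ Ideal.span {f}) :=
    Function.Injective.isDomain _ (IsFractionRing.injective (MvPolynomial (Fin 5) k ⧸ Ideal.span {f}) K)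
  obtain ⟨β, hβ0, hβ1⟩ := MonomialPBasisBlockForm.exists_blockBasis k f hf (Ideal.Quotient.mk (Ideal.span {f}) (X 0))
    (Ideal.Quotient.mk (Ideal.span {f}) (X 1)) (Ideal.Quotient.mk (Ideal.span {f}) (X 2)) (Ideal.Quotient.mk (Ideal.span {f}) (X 3))
    rfl rfl rfl rfl K
  exact LemmaNAssembly.isFrobeniusNormIdeal_pow_eight (MonomialPBasisBlockForm.two_eq_zero k f) _ _ _ _ _
    (MonomialPBasisBlockForm.relation k f hf _ _ _ _ _ rfl rfl rfl rfl rfl) (MonomialPBasisBlockForm.x_ne_zero k f hf _ rfl)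
    (MonomialPBasisBlockForm.z_ne_zero k f hf _ rfl) β hβ0 hβ1
    (fun w => MonomialPBasisBlockForm.exists_eq_sum_sq_blockGenerators k f hf _ _ _ _ _ rfl rfl rfl rfl rfl w)

/-! ## §3 The LEMMA-N♭ binder of `FCentreE1TierOneNormPow`, discharged at `n = 8`, `c = 1` -/

/-- ★★ **The `hN` binder of `FCentreE1TierOneNormPow.not_lFBAdm_two_one_four_of_normPow`, DISCHARGED for every perfect `k`** (text of the binder literally,
with `n = 8`, `c = 1`): for every fraction field `K` of the stalk `𝒪_v` at the vertex, `1 · 𝔮̄⁸·𝒪_v` is a first Frobenius norm ideal. The binder's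
`φ = germ_⊤ ∘ ΓSpecIso⁻¹ : A₀ → 𝒪_v` is Mathlib's `StructureSheaf.stalkAlgebra` (definitionally), a localisation at `v`; `K` is then a fraction field of `A₀` (§1),
LEMMA N♭ (§2) holds in `K`, and `IsFrobeniusNormIdeal.map_of_isLocalization` carries `𝔮̄⁸` to `𝒪_v`. [OURS] -/
theorem normPow_binder (k : Type) [Field k] [CharP k 2] [PerfectRing k 2] (f : MvPolynomial (Fin 5) k)
    (hf : f = X 4 ^ 2 + X 0 ^ 4 * X 4 + X 1 ^ 3 + X 2 ^ 3 + X 3 ^ 3)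
    (v : Spec (.of (MvPolynomial (Fin 5) k ⧸ Ideal.span {f})))
    (K : Type) [Field K] [Algebra ((Spec (.of (MvPolynomial (Fin 5) k ⧸ Ideal.span {f}))).presheaf.stalk v) K]
    [IsFractionRing ((Spec (.of (MvPolynomial (Fin 5) k ⧸ Ideal.span {f}))).presheaf.stalk v) K] [ExpChar K 2] :
    ∃ (n : ℕ) (c : (Spec (.of (MvPolynomial (Fin 5) k ⧸ Ideal.span {f}))).presheaf.stalk v), 0 < n ∧ c ≠ 0 ∧
      IsFrobeniusNormIdeal K 2 1 (Ideal.span {c} *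
        (Ideal.span {Ideal.Quotient.mk (Ideal.span {f}) (X 0) ^ 2, Ideal.Quotient.mk (Ideal.span {f}) (X 1),
            Ideal.Quotient.mk (Ideal.span {f}) (X 2), Ideal.Quotient.mk (Ideal.span {f}) (X 3), Ideal.Quotient.mk (Ideal.span {f}) (X 4)} ^ n).map
          ((((Spec (.of (MvPolynomial (Fin 5) k ⧸ Ideal.span {f}))).presheaf.germ ⊤ v trivial).hom.comp
            (Scheme.ΓSpecIso (.of (MvPolynomial (Fin 5) k ⧸ Ideal.span {f}))).inv.hom))) := by
  classical
  refine ⟨8, 1, by norm_num, one_ne_zero, ?_⟩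
  rw [Ideal.span_singleton_one, Ideal.top_mul]
  -- `A₀` is a domain; the stalk is the localisation of `A₀` at `v` (Mathlib's `stalkAlgebra`); `K` is a fraction field of `A₀` along the composite
  haveI hfp : (Ideal.span {f}).IsPrime :=
    (Ideal.span_singleton_prime (FCentreE1ChartWitness.prime_f k f hf).ne_zero).mpr (FCentreE1ChartWitness.prime_f k f hf)
  haveI : IsDomain (MvPolynomial (Fin 5) k ⧸ Ideal.span {f}) := Ideal.Quotient.isDomain _
  letI : Algebra (MvPolynomial (Fin 5) k ⧸ Ideal.span {f}) ((Spec (.of (MvPolynomial (Fin 5) k ⧸ Ideal.span {f}))).presheaf.stalk v) :=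
    StructureSheaf.stalkAlgebra (MvPolynomial (Fin 5) k ⧸ Ideal.span {f}) v
  haveI : IsLocalization.AtPrime ((Spec (.of (MvPolynomial (Fin 5) k ⧸ Ideal.span {f}))).presheaf.stalk v) v.asIdeal :=
    StructureSheaf.IsLocalization.to_stalk (MvPolynomial (Fin 5) k ⧸ Ideal.span {f}) v
  letI : Algebra (MvPolynomial (Fin 5) k ⧸ Ideal.span {f}) K :=
    ((algebraMap ((Spec (.of (MvPolynomial (Fin 5) k ⧸ Ideal.span {f}))).presheaf.stalk v) K).comp
      (algebraMap (MvPolynomial (Fin 5) k ⧸ Ideal.span {f}) ((Spec (.of (MvPolynomial (Fin 5) k ⧸ Ideal.span {f}))).presheaf.stalk v))).toAlgebra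
  haveI : IsScalarTower (MvPolynomial (Fin 5) k ⧸ Ideal.span {f}) ((Spec (.of (MvPolynomial (Fin 5) k ⧸ Ideal.span {f}))).presheaf.stalk v) K :=
    IsScalarTower.of_algebraMap_eq fun _ => rfl
  haveI : IsDomain ((Spec (.of (MvPolynomial (Fin 5) k ⧸ Ideal.span {f}))).presheaf.stalk v) :=
    Function.Injective.isDomain _ (IsFractionRing.injective ((Spec (.of (MvPolynomial (Fin 5) k ⧸ Ideal.span {f}))).presheaf.stalk v) K)
  haveI : IsFractionRing (MvPolynomial (Fin 5) k ⧸ Ideal.span {f}) K :=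
    isFractionRing_of_isLocalization_of_isFractionRing (S := (Spec (.of (MvPolynomial (Fin 5) k ⧸ Ideal.span {f}))).presheaf.stalk v)
      v.asIdeal.primeCompl (Ideal.primeCompl_le_nonZeroDivisors _)
  -- LEMMA N♭ at `A₀`, moved to the stalk along the localisation; `φ = algebraMap` definitionally
  exact FrobeniusNormExtendScale.IsFrobeniusNormIdeal.map_of_isLocalization (K := K) (B := MvPolynomial (Fin 5) k ⧸ Ideal.span {f})
    (B' := (Spec (.of (MvPolynomial (Fin 5) k ⧸ Ideal.span {f}))).presheaf.stalk v) v.asIdeal.primeCompl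
    (isFrobeniusNormIdeal_pow_eight_A₀ k f hf K)

/-! ## §4 The unconditional negative F-centre row -/

/-- ★★★ **`¬ LFBAdm 2 1 4`, UNCONDITIONAL**: at `d = 4`, `p = 2` the `e = 1` Frobenius-norm blow-up is NOT an admissible FULL-ifying centre — witnessed by the
wild inseparable double point `z² + x⁴z + y³ + u³ + t³` over `𝔽₂` at its vertex: its first Frobenius-norm blow-up is the blow-up along `𝔮̄⁸` (LEMMA N♭, §2/§3),
i.e. along `𝔮̄`, and the chart origin of that blow-up is NOT FULL (Tier 1, `FCentreE1TierOneNormPow.not_lFBAdm_two_one_four_of_normPow`).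
[OURS · first negative F-centre kernel row] -/
theorem not_lFBAdm_two_one_four : ¬ FCentreCandidate.LFBAdm 2 1 4 := by
  obtain ⟨v, hv⟩ := DoublePointFermatCubicGerm.exists_origin (ZMod 2)
    (X 4 ^ 2 + X 0 ^ 4 * X 4 + X 1 ^ 3 + X 2 ^ 3 + X 3 ^ 3 : MvPolynomial (Fin 5) (ZMod 2)) (FCentreE1ChartWitness.constantCoeff_f (ZMod 2) _ rfl)
  exact FCentreE1TierOneNormPow.not_lFBAdm_two_one_four_of_normPow (ZMod 2) _ rfl v hv fun K _ _ _ _ => normPow_binder (ZMod 2) _ rfl v K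

end Summit.ResolutionOfSingularities.ResolutionOfSingularities.Theorems.FInjectiveMacaulayfication.NotLFBAdmTwoOneFour

end
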